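import Literature.NumberTheory.EllipticCurves.IwasawaSelmerControlAwayFromPProofs
import Literature.NumberTheory.EllipticCurves.IwasawaLocalKummerSkeletonProofs
import Literature.NumberTheory.EllipticCurves.CyclotomicTowerLocalFrobeniusProofs
import Literature.NumberTheory.EllipticCurves.SerreOpenImageOrdinaryReductionProofs
import Literature.NumberTheory.EllipticCurves.GeomPointReduction
import HarnessLib

/-!
# The kernel of reduction at a good ordinary prime: local model, ordinary line, filtration

`Proofs` file (theorems only: no definition, no named fact) in topic
`NumberTheory/EllipticCurves`, first half of the local input (brick B) of the elementary proof of
Greenberg's Lemma 3.4 at the layer `n = 0` (R. Greenberg, LNM 1716 (1999), Lemma 3.4, p. 89, and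
§1 p. 62, §2 Props. 2.2, 2.4: at an ordinary prime the kernel of reduction
`ℱ[p^∞] = ker(E[p^∞] → Ẽ[p^∞])` is `≅ ℚ_p/ℤ_p`), feeding
`ResKernel.finite_primary_subgroupResKer_of_reduction` (`IwasawaLocalKummerSkeletonProofs`).

* §1 integers prime to `p` are units at the place `v ∋ p` of `ℚ`;
* §2 the local integral model `W_ℤ ⊗ 𝒪` of a globally minimal `E/ℚ` over a valuation ring `𝒪`
  of `K̄_v` (`localIntModel_baseChange`, `isUnit_Δ_localIntModel`: good reduction for `p ∤ Δ`);
* §3 **the ordinary line**: for `p ∤ Δ`, `p ∤ a_p` some `p`-torsion point of `E(K̄_v)` has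
  integral abscissa (`exists_zsmul_eq_zero_spectralValuation_le_one`) — Serre's division
  polynomial argument of `exists_zsmul_eq_zero_geomReduction_ne_zero`, replayed over `K̄_v`;
* §4 the reduction map `E(L) → Ē(𝒪/𝔪)` is onto for any valuation ring of an algebraically closed
  field (`reducePoint_surjective_of_isAlgClosed`, twin of `geomReduction_surjective`);
* §5 **the ordinary filtration** for a Weierstrass equation with unit discriminant over a
  valuation ring `𝒪` (residue characteristic `p`) of an algebraically closed `L` of
  characteristic `0`, under the ordinary hypothesis "some `p`-torsion point has non-zero
  reduction": `#Ē[p^r] ≤ p^r`, `#(E₁ ∩ E[p^r]) = p^r`, `red(E[p^r]) = Ē[p^r]`, `E₁` is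
  `p`-divisible, and `E₁ ∩ E[p^k]` is cyclic with a generator of order `p^k`
  (`natCard_torsionBy_ker_goodReductionHom_eq`, `exists_nsmul_eq_of_goodReductionHom_eq_zero`,
  `exists_generator_torsionBy_ker_goodReductionHom`).

## References

* [GreenbergLNM1716] R. Greenberg, *Iwasawa theory for elliptic curves*, LNM 1716 (1999), §1
  p. 62, §2 Props. 2.2, 2.4, §3 Lemma 3.4 (p. 89).
* [SilvermanAEC2009] J. H. Silverman, *The Arithmetic of Elliptic Curves*, V.3.1, VII.2.1,
  VII.3.1, III.6.4.
* J.-P. Serre, *Propriétés galoisiennes des points d'ordre fini des courbes elliptiques*, Invent.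
  Math. 15 (1972), §1.11.
* S. Lang, *Elliptic Functions* (1987), Ch. 9 §1.
-/

noncomputable section

open scoped Classical NNReal
open NumberField IsDedekindDomain Polynomial

attribute [-instance] DivisionRing.toRatAlgebra

namespace IsDedekindDomain.HeightOneSpectrum

open Literature.NumberTheory.EllipticCurves

variable {p : ℕ} [hp : Fact p.Prime] {v : HeightOneSpectrum (𝓞 ℚ)} (hpv : (p : 𝓞 ℚ) ∈ v.asIdeal)
  {w : Valuation (AlgebraicClosure (v.adicCompletion ℚ)) ℝ≥0}
  (hw : ∀ x, (w x : ℝ) = spectralNorm (v.adicCompletion ℚ) (AlgebraicClosure (v.adicCompletion ℚ)) x)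

/-! ## §1 Integers prime to `p` are units at `v = (p)` -/

include hpv in
/-- An integer prime to `p` does not lie in the place `v ∋ p` of `ℚ` (Bézout). [folklore] -/
theorem intCast_not_mem_asIdeal_of_natCast_mem {n : ℤ} (hn : ¬ (p : ℤ) ∣ n) : (n : 𝓞 ℚ) ∉ v.asIdeal := by
  intro hmem
  have hcop : IsCoprime (p : ℤ) n :=
    (Prime.coprime_iff_not_dvd (Nat.prime_iff_prime_int.mp hp.out)).mpr hn
  obtain ⟨a, b, hab⟩ := hcop
  apply v.isPrime.ne_top
  rw [Ideal.eq_top_iff_one]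
  have h1 : ((a * p + b * n : ℤ) : 𝓞 ℚ) = 1 := by rw [hab, Int.cast_one]
  rw [← h1]
  push_cast
  exact v.asIdeal.add_mem (v.asIdeal.mul_mem_left _ hpv) (v.asIdeal.mul_mem_left _ hmem)

include hpv hw in
/-- An integer prime to `p` has spectral valuation `1` on `K̄_v`, `v = (p)`. [folklore] -/
theorem spectralValuation_intCast_eq_one_of_natCast_mem {n : ℤ} (hn : ¬ (p : ℤ) ∣ n) :
    w (n : AlgebraicClosure (v.adicCompletion ℚ)) = 1 :=
  spectralValuation_intCast_eq_one hw (intCast_not_mem_asIdeal_of_natCast_mem hpv hn)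

end IsDedekindDomain.HeightOneSpectrum

namespace WeierstrassCurve

open Literature.NumberTheory.EllipticCurves Literature.NumberTheory.GaloisRepresentations Field
  IsDedekindDomain.HeightOneSpectrum

variable (W : WeierstrassCurve ℚ) [W.IsGloballyMinimal] {p : ℕ} [hp : Fact p.Prime]
  {v : HeightOneSpectrum (𝓞 ℚ)} (hpv : (p : 𝓞 ℚ) ∈ v.asIdeal)
  {w : Valuation (AlgebraicClosure (v.adicCompletion ℚ)) ℝ≥0}
  (hw : ∀ x, (w x : ℝ) = spectralNorm (v.adicCompletion ℚ) (AlgebraicClosure (v.adicCompletion ℚ)) x)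

/-! ## §2 The local integral model over the valuation ring of `K̄_v` -/

/-- Over `K̄_v` the local integral model `W_ℤ ⊗ 𝒪` of a globally minimal `W/ℚ` is `E` itself (both
are base changes of `integralModelInt W`). [folklore] -/
theorem localIntModel_baseChange (O : ValuationSubring (AlgebraicClosure (v.adicCompletion ℚ))) :
    ((integralModelInt W).map (algebraMap ℤ O)).baseChange (AlgebraicClosure (v.adicCompletion ℚ)) =
      W.baseChange (AlgebraicClosure (v.adicCompletion ℚ)) := by
  conv_rhs => rw [← map_integralModelInt W]
  rw [baseChange, baseChange, WeierstrassCurve.map_map, WeierstrassCurve.map_map]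
  congr 1
  exact RingHom.ext_int _ _

include hpv hw in
/-- **Good reduction of the local model**: for `p ∤ Δ_W` the discriminant of `W_ℤ ⊗ 𝒪_w` is a unit
(`w(Δ_W) = 1`). Silverman, *AEC*, VII.5.1(a). [folklore] -/
theorem isUnit_Δ_localIntModel (hΔ : ¬ (p : ℤ) ∣ minimalDiscriminantInt W) :
    IsUnit ((integralModelInt W).map (algebraMap ℤ w.valuationSubring)).Δ := by
  rw [map_Δ, (Valuation.valuationSubring.integers (v := w)).isUnit_iff_valuation_eq_one]
  change w (((integralModelInt W).Δ : ℤ) : AlgebraicClosure (v.adicCompletion ℚ)) = 1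
  exact spectralValuation_intCast_eq_one_of_natCast_mem hpv hw hΔ

/-! ## §3 The ordinary line: a `p`-torsion point of `E(K̄_v)` with integral abscissa -/

include hpv hw in
/-- **At a good ordinary prime some `p`-torsion point of `E(K̄_v)` is integral** (so reduces to a
point of order `p` of `Ē`, and the kernel of reduction meets `E[p]` in at most `p` points): for
`E/ℚ` globally minimal, `p ∤ Δ_E`, `p ∤ a_p`, there is `P = (x, y) ∈ E(K̄_v)[p]`, `v = (p)`, with
`w(x) ≤ 1`. Serre's argument (Invent. Math. 15 (1972), §1.11; Silverman, *AEC*, V.3.1 and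
VII.2.1), replayed over `K̄_v` from the tree's
`exists_zsmul_eq_zero_geomReduction_ne_zero`: `Ē` has a point of order `p`, so `ψ_p²(Ē)` is a
non-constant polynomial; an integral root of `ψ_p²(E)` lifting one of its roots (root lifting over
the algebraically closed valued field `K̄_v`) is the abscissa of an integral `p`-torsion point.
[cite: SilvermanAEC2009, Thm. V.3.1(a) and Prop. VII.2.1] -/
theorem exists_zsmul_eq_zero_spectralValuation_le_one [W.IsElliptic]
    (hΔ : ¬ (p : ℤ) ∣ minimalDiscriminantInt W) (hord : ¬ (p : ℤ) ∣ W.frobeniusTrace p) :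
    ∃ (x y : AlgebraicClosure (v.adicCompletion ℚ))
      (h : (W.baseChange (AlgebraicClosure (v.adicCompletion ℚ))).toAffine.Nonsingular x y),
      (p : ℤ) • (Affine.Point.some x y h :
        (W.baseChange (AlgebraicClosure (v.adicCompletion ℚ))).toAffine.Point) = 0 ∧ w x ≤ 1 := by
  haveI : (reductionModPrime W p).IsElliptic := isElliptic_reductionModPrime W hΔ
  set O : ValuationSubring (AlgebraicClosure (v.adicCompletion ℚ)) := w.valuationSubring with hOdef
  have hvO : w.Integers O := Valuation.valuationSubring.integers w
  set M : WeierstrassCurve O := (integralModelInt W).map (algebraMap ℤ O) with hMdef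
  have hMK := localIntModel_baseChange W O
  -- `p ∈ 𝔪_O`, so `O/𝔪` has characteristic `p`
  have hpO : w ((p : ℕ) : AlgebraicClosure (v.adicCompletion ℚ)) < 1 := by
    have h := spectralValuation_algebraMap_ringOfIntegers_lt_one (v := v) hw hpv
    rwa [map_natCast] at h
  haveI hchar : CharP (IsLocalRing.ResidueField O) p := by
    refine (CharP.charP_iff_prime_eq_zero hp.out).mpr ?_
    rw [← map_natCast (IsLocalRing.residue O), IsLocalRing.residue_eq_zero_iff]
    -- `p ∈ 𝔪_O ↔ w p < 1`
    rw [IsLocalRing.mem_maximalIdeal, mem_nonunits_iff, hvO.isUnit_iff_valuation_eq_one]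
    exact fun h ↦ absurd h (ne_of_lt (by simpa using hpO))
  -- Step A: `ψ_p²(Ẽ)` is not constant (it is non-zero and has a root over `𝔽̄_p`)
  set Ebar : WeierstrassCurve (AlgebraicClosure (ZMod p)) :=
    (reductionModPrime W p).baseChange (AlgebraicClosure (ZMod p)) with hEbar
  have hmapE : ((reductionModPrime W p).ΨSq p).map
      (algebraMap (ZMod p) (AlgebraicClosure (ZMod p))) = Ebar.ΨSq p := by
    rw [hEbar, baseChange, ← map_ΨSq]
  have hΨdeg : ((reductionModPrime W p).ΨSq p).natDegree ≠ 0 := by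
    obtain ⟨Q, hQ0, hpQ⟩ := exists_ne_zero_nsmul_eq_zero_of_not_dvd_frobeniusTrace p hΔ hord
    obtain ⟨u, hu⟩ : ∃ u, (Ebar.ΨSq p).eval u = 0 := by
      rcases Q with _ | ⟨u, w', huw⟩
      · exact absurd rfl hQ0
      · refine ⟨u, ?_⟩
        rw [← zsmul_some_eq_zero_iff_eval_ΨSq Ebar huw p, natCast_zsmul]
        exact hpQ
    have hne : Ebar.ΨSq p ≠ 0 := by
      intro h0
      have hp1 : ((p + 1 : ℕ) : AlgebraicClosure (ZMod p)) ≠ 0 := by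
        rw [Nat.cast_succ, CharP.cast_eq_zero (AlgebraicClosure (ZMod p)) p, zero_add]
        exact one_ne_zero
      have hcard := card_torsionBy_eq_sq (E := Ebar) hp1
      haveI : Finite (AddSubgroup.torsionBy Ebar.toAffine.Point ((p + 1 : ℕ) : ℤ)) :=
        Nat.finite_of_card_ne_zero (by rw [hcard]; positivity)
      have h1 : 1 < Nat.card (AddSubgroup.torsionBy Ebar.toAffine.Point ((p + 1 : ℕ) : ℤ)) := by
        rw [hcard]
        nlinarith [hp.out.two_le]
      haveI := (Finite.one_lt_card_iff_nontrivial.mp h1)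
      obtain ⟨⟨R, hR⟩, hR0⟩ :=
        exists_ne (0 : AddSubgroup.torsionBy Ebar.toAffine.Point ((p + 1 : ℕ) : ℤ))
      have hR' : ((p + 1 : ℕ) : ℤ) • R = 0 := (Submodule.mem_torsionBy_iff _ _).mp hR
      rcases R with _ | ⟨u', w', h'⟩
      · exact hR0 (Subtype.ext rfl)
      · have hpR : (p : ℤ) • (Affine.Point.some u' w' h' : Ebar.toAffine.Point) = 0 := by
          rw [zsmul_some_eq_zero_iff_eval_ΨSq Ebar h', h0, eval_zero]
        have h1R : (1 : ℤ) • (Affine.Point.some u' w' h' : Ebar.toAffine.Point) = 0 := by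
          rw [show (1 : ℤ) = ((p + 1 : ℕ) : ℤ) - p by push_cast; ring, sub_zsmul, hR', hpR]
          simp
        rw [one_zsmul] at h1R
        exact Affine.Point.some_ne_zero h' h1R
    intro h0
    have h0' : (Ebar.ΨSq p).natDegree = 0 := by
      rw [← hmapE, natDegree_map_eq_of_injective (RingHom.injective _), h0]
    rw [eq_C_of_natDegree_eq_zero h0', eval_C] at hu
    apply hne
    rw [eq_C_of_natDegree_eq_zero h0', hu, C_0]
  -- Step B: the reduction of `F = ψ_p²(M) ∈ O[X]` is not constant
  set F : O[X] := M.ΨSq p with hFdef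
  have hFred : F.map (IsLocalRing.residue O) =
      ((reductionModPrime W p).ΨSq p).map (ZMod.castHom (dvd_refl p) (IsLocalRing.ResidueField O)) := by
    rw [hFdef, hMdef, ← map_ΨSq, ← map_ΨSq, WeierstrassCurve.map_map, WeierstrassCurve.map_map]
    congr 2
    exact RingHom.ext_int _ _
  have hdeg : (F.map (IsLocalRing.residue O)).natDegree ≠ 0 := by
    rw [hFred, natDegree_map_eq_of_injective (RingHom.injective _)]
    exact hΨdeg
  obtain ⟨a, ha⟩ := exists_isRoot_of_natDegree_map_residue_ne_zero O F hdeg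
  -- Step C: an integral ordinate over `a`
  set c₁ : O := M.a₁ * a + M.a₃ with hc₁
  set c₀ : O := a ^ 3 + M.a₂ * a ^ 2 + M.a₄ * a + M.a₆ with hc₀
  have hlt2 : (C c₁ * X - C c₀).degree < ((2 : ℕ) : WithBot ℕ) :=
    (degree_sub_le _ _).trans_lt
      (max_lt ((degree_C_mul_X_le _).trans_lt (by decide)) (degree_C_le.trans_lt (by decide)))
  have hqm : (X ^ 2 + (C c₁ * X - C c₀) : O[X]).Monic := monic_X_pow_add hlt2
  have hlt : (C c₁ * X - C c₀).degree < (X ^ 2 : O[X]).degree := by rwa [degree_X_pow]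
  have hqnat : (X ^ 2 + (C c₁ * X - C c₀) : O[X]).natDegree = 2 := by
    rw [natDegree_add_eq_left_of_degree_lt hlt, natDegree_X_pow]
  have hqdeg : ((X ^ 2 + (C c₁ * X - C c₀) : O[X]).map (IsLocalRing.residue O)).natDegree ≠ 0 := by
    rw [hqm.natDegree_map, hqnat]
    exact two_ne_zero
  obtain ⟨b, hb⟩ := exists_isRoot_of_natDegree_map_residue_ne_zero O _ hqdeg
  have hrootb : b ^ 2 + c₁ * b - c₀ = 0 := by
    have : b ^ 2 + (c₁ * b - c₀) = 0 := by
      have h := hb.eq_zero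
      simpa only [eval_add, eval_sub, eval_pow, eval_mul, eval_X, eval_C] using h
    linear_combination this
  have hab : b ^ 2 + (M.a₁ * a + M.a₃) * b = a ^ 3 + M.a₂ * a ^ 2 + M.a₄ * a + M.a₆ := by
    rw [hc₁, hc₀] at hrootb
    linear_combination hrootb
  -- Step D: the integral point `(a, b) ∈ E(K̄_v)[p]`
  have heqO : M.toAffine.Equation a b := by
    rw [Affine.equation_iff]
    linear_combination hab
  have heqK : (W.baseChange (AlgebraicClosure (v.adicCompletion ℚ))).toAffine.Equation
      (a : AlgebraicClosure (v.adicCompletion ℚ)) (b : AlgebraicClosure (v.adicCompletion ℚ)) := by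
    rw [← hMK]
    exact (map_equation_iff hvO.hom_inj).mpr heqO
  have hns : (W.baseChange (AlgebraicClosure (v.adicCompletion ℚ))).toAffine.Nonsingular
      (a : AlgebraicClosure (v.adicCompletion ℚ)) (b : AlgebraicClosure (v.adicCompletion ℚ)) :=
    (Affine.equation_iff_nonsingular).mp heqK
  refine ⟨a, b, hns, ?_, (Valuation.mem_valuationSubring_iff w _).mp a.2⟩
  rw [zsmul_some_eq_zero_iff_eval_ΨSq _ hns p, ← hMK]
  change ((M.map (algebraMap O (AlgebraicClosure (v.adicCompletion ℚ)))).ΨSq p).eval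
    (algebraMap O (AlgebraicClosure (v.adicCompletion ℚ)) a) = 0
  rw [map_ΨSq, eval_map, eval₂_at_apply, ← hFdef, ha.eq_zero, map_zero]

/-! ## §4 The reduction map of the local model is onto -/

/-- In a field, a root `w` of `Y² + γY - δ` with `β² + γβ - δ = 0` is `β` or `-γ - β`. [folklore] -/
theorem eq_or_eq_of_quadratic' {L : Type*} [Field L] {w β γ δ : L}
    (hw : w ^ 2 + γ * w = δ) (hβ : β ^ 2 + γ * β - δ = 0) : w = β ∨ w = -γ - β := by
  have key : (w - β) * (w - (-γ - β)) = 0 := by linear_combination hw - hβ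
  rcases mul_eq_zero.mp key with h | h
  · exact Or.inl (sub_eq_zero.mp h)
  · exact Or.inr (sub_eq_zero.mp h)

/-- **The reduction map `E(L) → Ē(𝒪/𝔪)` is onto for a Weierstrass equation with unit
discriminant over a valuation ring `𝒪` of an algebraically closed field `L`** (Lang, *Elliptic
Functions*, Ch. 9 §1; Silverman, *AEC*, VII.2.1): lift `u = ā`, take an integral root `b` of the
monic quadratic `Y² + (a₁a + a₃)Y - (a³ + a₂a² + a₄a + a₆)` (root lifting over the algebraically
closed `L`) or its conjugate `-(a₁a + a₃) - b`; one of `(a, b)`, `(a, b')` reduces to `(u, w)`.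
The local twin of `geomReduction_surjective`. [cite: SilvermanAEC2009, Prop. VII.2.1] -/
theorem reducePoint_surjective_of_isAlgClosed {L : Type*} [Field L] [IsAlgClosed L]
    (O : ValuationSubring L) (M : WeierstrassCurve O) (hΔu : IsUnit M.Δ)
    (Q : (M.map (IsLocalRing.residue O)).toAffine.Point) :
    ∃ P : (M.baseChange L).toAffine.Point, reducePoint M P = Q := by
  have hinj : Function.Injective (algebraMap O L) := fun _ _ h ↦ Subtype.ext h
  haveI hM : M.IsElliptic := ⟨hΔu⟩
  haveI := isElliptic_map_residue (W := M) hΔu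
  rcases Q with _ | ⟨u, w', hQ⟩
  · exact ⟨0, reducePoint_zero⟩
  obtain ⟨a, rfl⟩ := IsLocalRing.residue_surjective u
  -- the monic quadratic in `Y` at `X = a` and an integral root `b₁`
  set c₁ : O := M.a₁ * a + M.a₃ with hc₁
  set c₀ : O := a ^ 3 + M.a₂ * a ^ 2 + M.a₄ * a + M.a₆ with hc₀
  have hlt2 : (C c₁ * X - C c₀).degree < ((2 : ℕ) : WithBot ℕ) :=
    (degree_sub_le _ _).trans_lt
      (max_lt ((degree_C_mul_X_le _).trans_lt (by decide)) (degree_C_le.trans_lt (by decide)))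
  have hlt : (C c₁ * X - C c₀).degree < (X ^ 2 : O[X]).degree := by rwa [degree_X_pow]
  have hqm : (X ^ 2 + (C c₁ * X - C c₀) : O[X]).Monic := monic_X_pow_add hlt2
  have hqnat : (X ^ 2 + (C c₁ * X - C c₀) : O[X]).natDegree = 2 := by
    rw [natDegree_add_eq_left_of_degree_lt hlt, natDegree_X_pow]
  have hqdeg : ((X ^ 2 + (C c₁ * X - C c₀) : O[X]).map (IsLocalRing.residue O)).natDegree ≠ 0 := by
    rw [hqm.natDegree_map, hqnat]
    exact two_ne_zero
  obtain ⟨b₁, hb₁⟩ := exists_isRoot_of_natDegree_map_residue_ne_zero O _ hqdeg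
  have hroot : b₁ ^ 2 + c₁ * b₁ - c₀ = 0 := by
    have : b₁ ^ 2 + (c₁ * b₁ - c₀) = 0 := by
      have h := hb₁.eq_zero
      simpa only [eval_add, eval_sub, eval_pow, eval_mul, eval_X, eval_C] using h
    linear_combination this
  -- downstairs: `w'` is `b̄₁` or `b̄₂`, `b₂ = -c₁ - b₁`
  have hQeq := (Affine.equation_iff _ _).mp hQ.1
  simp only [map_a₁, map_a₂, map_a₃, map_a₄, map_a₆] at hQeq
  have hw' : w' ^ 2 + IsLocalRing.residue O c₁ * w' = IsLocalRing.residue O c₀ := by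
    rw [hc₁, hc₀]
    simp only [map_add, map_mul, map_pow]
    linear_combination hQeq
  have hβ : IsLocalRing.residue O b₁ ^ 2 + IsLocalRing.residue O c₁ * IsLocalRing.residue O b₁ -
      IsLocalRing.residue O c₀ = 0 := by
    have := congrArg (IsLocalRing.residue O) hroot
    simpa only [map_add, map_sub, map_mul, map_pow, map_zero] using this
  -- the lift `(a, b)` with `b ∈ {b₁, b₂}`
  have hlift : ∀ b : O, b ^ 2 + c₁ * b - c₀ = 0 → w' = IsLocalRing.residue O b →
      ∃ P : (M.baseChange L).toAffine.Point,
        reducePoint M P = .some (IsLocalRing.residue O a) w' hQ := by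
    intro b hb hwb
    subst hwb
    have heqO : M.toAffine.Equation a b := by
      rw [Affine.equation_iff]
      rw [hc₁, hc₀] at hb
      linear_combination hb
    have hnsO : M.toAffine.Nonsingular a b := (Affine.equation_iff_nonsingular).mp heqO
    have hnsK : (M.baseChange L).toAffine.Nonsingular (algebraMap O L a) (algebraMap O L b) :=
      (Affine.map_nonsingular _ hinj a b).mpr hnsO
    exact ⟨.some _ _ hnsK, reducePoint_some_algebraMap hinj hnsK hQ⟩
  rcases eq_or_eq_of_quadratic' hw' hβ with h | h
  · exact hlift b₁ hroot h
  · refine hlift (-c₁ - b₁) (by linear_combination hroot) ?_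
    rw [h, map_sub, map_neg]

end WeierstrassCurve

namespace Literature.NumberTheory.EllipticCurves

open _root_.WeierstrassCurve _root_.AddSubgroup

/-! ## §5 The ordinary filtration: `E₁ ∩ E[p^r]` has at most `p^r` points, reduction is onto on
`p^r`-torsion, `E₁` is `p`-divisible, `E₁ ∩ E[p^k]` is cyclic -/

section OrdinaryFiltration

variable {L : Type*} [Field L] [IsAlgClosed L] [CharZero L] (O : ValuationSubring L)
  {Γ₀ : Type*} [LinearOrderedCommGroupWithZero Γ₀] {v : Valuation L Γ₀} (hv : v.Integers O)
  {M : WeierstrassCurve O} (hΔu : IsUnit M.Δ) {p : ℕ} [hp : Fact p.Prime]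
  [CharP (IsLocalRing.ResidueField O) p]

/-- A general injection bound: an injective additive map into a group with at most `c` elements of
`n`-torsion bounds the `n`-torsion of the source by `c`. [folklore] -/
theorem natCard_torsionBy_le_of_injective {A B : Type*} [AddCommGroup A] [AddCommGroup B]
    (f : A →+ B) (hf : Function.Injective f) (n : ℤ) (hfin : Finite (torsionBy B n)) {c : ℕ}
    (hB : Nat.card (torsionBy B n) ≤ c) : Nat.card (torsionBy A n) ≤ c := by
  refine (Nat.card_le_card_of_injective (fun a : torsionBy A n ↦ (⟨f a, ?_⟩ : torsionBy B n))
    ?_).trans hB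
  · rw [mem_torsionBy_iff, ← map_zsmul f, mem_torsionBy_iff.mp a.2, map_zero]
  · intro a b h
    exact Subtype.ext (hf (congrArg Subtype.val h))

omit [IsAlgClosed L] [CharZero L] in
include hΔu in
/-- **`#Ē(k)[p^r] ≤ p^r`** for the reduction `Ē = M mod 𝔪` of a Weierstrass equation with unit
discriminant over a valuation ring with residue characteristic `p` (the `p^r`-torsion of an
elliptic curve in characteristic `p` has at most `p^r` geometric points, Silverman, *AEC*,
V.3.1(a); the tree's `natCard_geomTorsion_expChar_pow_le`, pulled back along `Ē(k) ↪ Ē(k̄)`).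
[cite: SilvermanAEC2009, Thm. V.3.1(a)] -/
theorem natCard_torsionBy_point_map_residue_le (r : ℕ) :
    Nat.card (torsionBy (M.map (IsLocalRing.residue O)).toAffine.Point ((p ^ r : ℕ) : ℤ)) ≤ p ^ r := by
  haveI := isElliptic_map_residue (W := M) hΔu
  haveI : ExpChar (IsLocalRing.ResidueField O) p := ExpChar.prime hp.out
  have hp0 : ((p ^ r : ℕ) : ℤ) ≠ 0 := by exact_mod_cast pow_ne_zero r hp.out.ne_zero
  exact natCard_torsionBy_le_of_injective
    ((M.map (IsLocalRing.residue O)).mapPointHom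
      (algebraMap (IsLocalRing.ResidueField O) (AlgebraicClosure (IsLocalRing.ResidueField O))))
    (mapPointHom_injective _ _) _
    (finite_torsionBy_baseChange (M.map (IsLocalRing.residue O))
      (AlgebraicClosure (IsLocalRing.ResidueField O)) hp0)
    (natCard_geomTorsion_expChar_pow_le (M.map (IsLocalRing.residue O)) p r)

include hΔu in
/-- `E(L)[m]` is finite (`#E[m] = m²`, `L` algebraically closed of characteristic `0`) for the
base change of a Weierstrass equation with unit discriminant. [folklore] -/
theorem finite_torsionBy_point_baseChange {m : ℕ} (hm : m ≠ 0) :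
    Finite (torsionBy (M.baseChange L).toAffine.Point (m : ℤ)) := by
  haveI hM : M.IsElliptic := ⟨hΔu⟩
  have h := card_torsionBy_eq_sq (E := M.baseChange L) (n := m) (by exact_mod_cast hm)
  exact Nat.finite_of_card_ne_zero (by rw [h]; positivity)

omit [CharP (IsLocalRing.ResidueField O) p] in
include hv hΔu in
/-- **The ordinary filtration, level `r`: `#(E₁ ∩ E[p^r]) ≤ p^r`.** If some `p`-torsion point of
`E(L)` has non-zero reduction, then the `p^r`-torsion of the kernel of reduction `E₁(L)` has at
most `p^r` points (`E₁ ∩ E[p]` is a proper subgroup of `E[p] ≅ (ℤ/p)²`, so has `≤ p` elements; then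
induct with `#A[p^{r+1}] ≤ #A[p] · #A[p^r]`). Greenberg, LNM 1716, p. 62 (ordinary:
`ker(E[p^∞] → Ẽ[p^∞]) ≅ ℚ_p/ℤ_p`); Silverman, *AEC*, VII.2.1–2.2. [cite: GreenbergLNM1716, §1 p. 62] -/
theorem natCard_torsionBy_ker_goodReductionHom_le
    (hord : ∃ P : (M.baseChange L).toAffine.Point, (p : ℤ) • P = 0 ∧ goodReductionHom M hv hΔu P ≠ 0)
    (r : ℕ) :
    Nat.card (torsionBy (goodReductionHom M hv hΔu).ker ((p : ℤ) ^ r)) ≤ p ^ r := by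
  haveI hM : M.IsElliptic := ⟨hΔu⟩
  set red := goodReductionHom M hv hΔu with hred
  have hpz : (p : ℤ) ≠ 0 := by exact_mod_cast hp.out.ne_zero
  have hfinV : ∀ k : ℕ, Finite (torsionBy (M.baseChange L).toAffine.Point ((p : ℤ) ^ k)) := fun k ↦ by
    have h := finite_torsionBy_point_baseChange O hΔu (pow_ne_zero k hp.out.ne_zero)
    rwa [Nat.cast_pow] at h
  have hfin : ∀ k : ℕ, Finite (torsionBy red.ker ((p : ℤ) ^ k)) := fun k ↦
    finite_torsionBy_of_injective red.ker.subtype red.ker.subtype_injective _ (hfinV k)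
  refine natCard_torsionBy_pow_le hfin ?_ r
  -- level one: `E₁ ∩ E[p]` is a proper subgroup of `E[p]`, which has `p²` elements
  obtain ⟨P, hpP, hP⟩ := hord
  haveI : Finite (torsionBy (M.baseChange L).toAffine.Point (p : ℤ)) := by
    simpa using hfinV 1
  haveI : Finite (torsionBy red.ker (p : ℤ)) := by simpa using hfin 1
  have hcard : Nat.card (torsionBy (M.baseChange L).toAffine.Point (p : ℤ)) = p ^ 2 :=
    card_torsionBy_eq_sq (E := M.baseChange L) (by exact_mod_cast hp.out.ne_zero)
  -- the inclusion `E₁[p] → E[p]` and its range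
  let ι : torsionBy red.ker (p : ℤ) →+ torsionBy (M.baseChange L).toAffine.Point (p : ℤ) :=
    { toFun := fun x ↦ ⟨((x : red.ker) : (M.baseChange L).toAffine.Point), by
        have hx := congrArg (red.ker.subtype) (mem_torsionBy_iff.mp x.2)
        rw [map_zsmul, map_zero] at hx
        exact mem_torsionBy_iff.mpr hx⟩
      map_zero' := rfl
      map_add' := fun _ _ ↦ rfl }
  have hι : Function.Injective ι := fun x y h ↦
    Subtype.ext (Subtype.ext (congrArg (fun z : torsionBy (M.baseChange L).toAffine.Point (p : ℤ) ↦
      (z : (M.baseChange L).toAffine.Point)) h))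
  have hrange : Nat.card ι.range = Nat.card (torsionBy red.ker (p : ℤ)) :=
    (Nat.card_congr (ι.ofInjective hι).toEquiv).symm
  have hdvd : Nat.card ι.range ∣ p ^ 2 := hcard ▸ ι.range.card_addSubgroup_dvd_card
  have hne : Nat.card ι.range ≠ p ^ 2 := by
    intro h
    have htop : ι.range = ⊤ := AddSubgroup.eq_top_of_card_eq _ (h.trans hcard.symm)
    have hPmem : (⟨P, mem_torsionBy_iff.mpr hpP⟩ : torsionBy (M.baseChange L).toAffine.Point (p : ℤ)) ∈
        ι.range := by rw [htop]; exact AddSubgroup.mem_top _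
    obtain ⟨x, hx⟩ := hPmem
    apply hP
    have hxP : ((x : red.ker) : (M.baseChange L).toAffine.Point) = P := congrArg Subtype.val hx
    rw [← hxP]
    exact (x : red.ker).2
  obtain ⟨i, hi, hci⟩ := (Nat.dvd_prime_pow hp.out).mp hdvd
  rw [← hrange, hci]
  interval_cases i
  · simpa using hp.out.one_le
  · simp
  · exact absurd hci hne

omit [IsAlgClosed L] [CharZero L] [CharP (IsLocalRing.ResidueField O) p] in
include hΔu in
/-- `Ē(k)[n]` is finite for `n ≠ 0` (it embeds in `Ē(k̄)[n]`). [folklore] -/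
theorem finite_torsionBy_point_map_residue {n : ℤ} (hn : n ≠ 0) :
    Finite (torsionBy (M.map (IsLocalRing.residue O)).toAffine.Point n) := by
  haveI := isElliptic_map_residue (W := M) hΔu
  exact finite_torsionBy_of_injective
    ((M.map (IsLocalRing.residue O)).mapPointHom
      (algebraMap (IsLocalRing.ResidueField O) (AlgebraicClosure (IsLocalRing.ResidueField O))))
    (mapPointHom_injective _ _) n
    (finite_torsionBy_baseChange (M.map (IsLocalRing.residue O))
      (AlgebraicClosure (IsLocalRing.ResidueField O)) hn)

include hv hΔu in
/-- **Counting: `#E[p^r] = #red(E[p^r]) · #ker`, so `red(E[p^r]) = Ē[p^r]` and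
`#(E₁ ∩ E[p^r]) = p^r`** under the ordinary hypothesis (`#E[p^r] = p^{2r}` over the algebraically
closed `L` of characteristic `0`, `#(E₁ ∩ E[p^r]) ≤ p^r`, `#Ē[p^r] ≤ p^r`): the reduction map is
onto on `p^r`-torsion and the `p^r`-torsion of the kernel of reduction has exactly `p^r` points.
Greenberg, LNM 1716, p. 62 (`0 → ℱ[p^∞] → E[p^∞] → Ẽ[p^∞] → 0` at an ordinary prime).
[cite: GreenbergLNM1716, §1 p. 62] -/
theorem natCard_torsionBy_ker_goodReductionHom_eq
    (hord : ∃ P : (M.baseChange L).toAffine.Point, (p : ℤ) • P = 0 ∧ goodReductionHom M hv hΔu P ≠ 0)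
    (r : ℕ) :
    Nat.card (torsionBy (goodReductionHom M hv hΔu).ker ((p : ℤ) ^ r)) = p ^ r ∧
      ∀ Q : (M.map (IsLocalRing.residue O)).toAffine.Point, ((p ^ r : ℕ) : ℤ) • Q = 0 →
        ∃ P : (M.baseChange L).toAffine.Point,
          ((p ^ r : ℕ) : ℤ) • P = 0 ∧ goodReductionHom M hv hΔu P = Q := by
  haveI hM : M.IsElliptic := ⟨hΔu⟩
  set red := goodReductionHom M hv hΔu with hred
  have hpr0 : p ^ r ≠ 0 := pow_ne_zero r hp.out.ne_zero
  have hcast : ((p ^ r : ℕ) : ℤ) = (p : ℤ) ^ r := Nat.cast_pow p r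
  haveI hfinT : Finite (torsionBy (M.baseChange L).toAffine.Point ((p ^ r : ℕ) : ℤ)) :=
    finite_torsionBy_point_baseChange O hΔu hpr0
  haveI hfinA : Finite (torsionBy (M.map (IsLocalRing.residue O)).toAffine.Point ((p ^ r : ℕ) : ℤ)) :=
    finite_torsionBy_point_map_residue O hΔu (by exact_mod_cast hpr0)
  haveI hfinK : Finite (torsionBy red.ker ((p : ℤ) ^ r)) := by
    have h := finite_torsionBy_of_injective red.ker.subtype red.ker.subtype_injective
      ((p ^ r : ℕ) : ℤ) hfinT
    rwa [hcast] at h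
  have hcardT : Nat.card (torsionBy (M.baseChange L).toAffine.Point ((p ^ r : ℕ) : ℤ)) = (p ^ r) ^ 2 :=
    card_torsionBy_eq_sq (E := M.baseChange L) (by exact_mod_cast hpr0)
  have hker_le := natCard_torsionBy_ker_goodReductionHom_le O hv hΔu hord r
  have hA := natCard_torsionBy_point_map_residue_le O hΔu (p := p) r
  -- the restriction of `red` to `E[p^r] → Ē[p^r]`
  let redT : torsionBy (M.baseChange L).toAffine.Point ((p ^ r : ℕ) : ℤ) →+
      torsionBy (M.map (IsLocalRing.residue O)).toAffine.Point ((p ^ r : ℕ) : ℤ) :=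
    { toFun := fun x ↦ ⟨red (x : (M.baseChange L).toAffine.Point), by
        rw [mem_torsionBy_iff, ← map_zsmul, mem_torsionBy_iff.mp x.2, map_zero]⟩
      map_zero' := Subtype.ext (map_zero red)
      map_add' := fun x y ↦ Subtype.ext (map_add red _ _) }
  have hredT : ∀ x, ((redT x : torsionBy (M.map (IsLocalRing.residue O)).toAffine.Point
      ((p ^ r : ℕ) : ℤ)) : (M.map (IsLocalRing.residue O)).toAffine.Point) =
      red (x : (M.baseChange L).toAffine.Point) := fun x ↦ rfl
  -- its kernel injects into `E₁ ∩ E[p^r]`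
  let κ : redT.ker → torsionBy red.ker ((p : ℤ) ^ r) := fun x ↦
    ⟨⟨((x : torsionBy (M.baseChange L).toAffine.Point ((p ^ r : ℕ) : ℤ)) :
        (M.baseChange L).toAffine.Point), by
      have hx : redT x = 0 := x.2
      exact congrArg Subtype.val hx⟩, by
      rw [mem_torsionBy_iff]
      apply red.ker.subtype_injective
      rw [map_zsmul, map_zero, ← hcast]
      exact mem_torsionBy_iff.mp
        (x : torsionBy (M.baseChange L).toAffine.Point ((p ^ r : ℕ) : ℤ)).2⟩
  have hκ : Function.Injective κ := by
    intro x y h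
    apply Subtype.ext; apply Subtype.ext
    exact congrArg (fun z : torsionBy red.ker ((p : ℤ) ^ r) ↦
      ((z : red.ker) : (M.baseChange L).toAffine.Point)) h
  have hkerT : Nat.card redT.ker ≤ Nat.card (torsionBy red.ker ((p : ℤ) ^ r)) :=
    Nat.card_le_card_of_injective κ hκ
  -- counting
  haveI : Finite redT.range := Finite.of_surjective _ redT.rangeRestrict_surjective
  have hmul : Nat.card (torsionBy (M.baseChange L).toAffine.Point ((p ^ r : ℕ) : ℤ)) =
      Nat.card redT.range * Nat.card redT.ker := by
    rw [AddSubgroup.card_eq_card_quotient_mul_card_addSubgroup redT.ker,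
      Nat.card_congr (QuotientAddGroup.quotientKerEquivRange redT).toEquiv]
  have hrange_le : Nat.card redT.range ≤ p ^ r :=
    (Nat.card_le_card_of_injective _ redT.range.subtype_injective).trans hA
  rw [hcardT, sq] at hmul
  -- `p^r · p^r = #range · #kerT` with `#range ≤ p^r`, `#kerT ≤ #(E₁ ∩ E[p^r]) ≤ p^r`
  have hkerT' : Nat.card redT.ker ≤ p ^ r := hkerT.trans hker_le
  have hrange_eq : Nat.card redT.range = p ^ r := by
    refine le_antisymm hrange_le ?_
    by_contra hlt
    push Not at hlt
    have h1 : Nat.card redT.range * Nat.card redT.ker < p ^ r * p ^ r :=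
      Nat.mul_lt_mul_of_lt_of_le hlt hkerT' (Nat.pos_of_ne_zero hpr0)
    rw [← hmul] at h1
    exact lt_irrefl _ h1
  have hker_eq : Nat.card redT.ker = p ^ r := by
    rw [hrange_eq] at hmul
    exact (Nat.eq_of_mul_eq_mul_left (Nat.pos_of_ne_zero hpr0) hmul).symm
  refine ⟨le_antisymm hker_le (hker_eq ▸ hkerT), fun Q hQ ↦ ?_⟩
  -- `range = Ē[p^r]`
  have htop : redT.range = ⊤ :=
    AddSubgroup.eq_top_of_card_eq _ (le_antisymm
      (Nat.card_le_card_of_injective _ redT.range.subtype_injective) (by rw [hrange_eq]; exact hA))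
  have hmem : (⟨Q, mem_torsionBy_iff.mpr hQ⟩ :
      torsionBy (M.map (IsLocalRing.residue O)).toAffine.Point ((p ^ r : ℕ) : ℤ)) ∈ redT.range := by
    rw [htop]; exact AddSubgroup.mem_top _
  obtain ⟨x, hx⟩ := hmem
  refine ⟨x, mem_torsionBy_iff.mp x.2, ?_⟩
  rw [← hredT, hx]

include hv hΔu in
/-- **`E₁(L)` is `p`-divisible** at an ordinary prime: for `Q` in the kernel of reduction there is
`R` in the kernel of reduction with `pR = Q` (divide in `E(L)`, `L` algebraically closed, then
correct by a `p`-torsion point with the same reduction, which exists since `red(E[p]) = Ē[p]`).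
Hypothesis (div₁) of `ResKernel.finite_primary_subgroupResKer_of_reduction`.
[cite: GreenbergLNM1716, §1 p. 62] -/
theorem exists_nsmul_eq_of_goodReductionHom_eq_zero
    (hord : ∃ P : (M.baseChange L).toAffine.Point, (p : ℤ) • P = 0 ∧ goodReductionHom M hv hΔu P ≠ 0)
    (Q : (M.baseChange L).toAffine.Point) (hQ : goodReductionHom M hv hΔu Q = 0) :
    ∃ R : (M.baseChange L).toAffine.Point, goodReductionHom M hv hΔu R = 0 ∧ p • R = Q := by
  haveI hM : M.IsElliptic := ⟨hΔu⟩
  obtain ⟨R₀, hR₀⟩ := nsmul_surjective_of_isAlgClosed (V := M.baseChange L) hp.out.ne_zero Q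
  have hR₀ : p • R₀ = Q := hR₀
  have hred₀ : ((p ^ 1 : ℕ) : ℤ) • goodReductionHom M hv hΔu R₀ = 0 := by
    rw [pow_one, natCast_zsmul, ← map_nsmul, hR₀, hQ]
  obtain ⟨t, ht, hredt⟩ :=
    (natCard_torsionBy_ker_goodReductionHom_eq O hv hΔu hord 1).2 _ hred₀
  refine ⟨R₀ - t, by rw [map_sub, hredt, sub_self], ?_⟩
  rw [smul_sub, hR₀]
  rw [pow_one, natCast_zsmul] at ht
  rw [ht, sub_zero]

include hv hΔu in
/-- **`E₁ ∩ E[p^k]` is cyclic of order `p^k`** at an ordinary prime, with a generator `P₀` of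
order exactly `p^k`: every `p^k`-torsion point of the kernel of reduction is a multiple of `P₀`
(`#(E₁ ∩ E[p^j]) = p^j` for all `j`, so an element outside `E₁ ∩ E[p^{k-1}]` has order `p^k` and
generates). Greenberg, LNM 1716, p. 62 (`ℱ[p^∞] ≅ ℚ_p/ℤ_p`). [cite: GreenbergLNM1716, §1 p. 62] -/
theorem exists_generator_torsionBy_ker_goodReductionHom
    (hord : ∃ P : (M.baseChange L).toAffine.Point, (p : ℤ) • P = 0 ∧ goodReductionHom M hv hΔu P ≠ 0)
    (k : ℕ) :
    ∃ P₀ : (M.baseChange L).toAffine.Point, goodReductionHom M hv hΔu P₀ = 0 ∧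
      addOrderOf P₀ = p ^ k ∧
      ∀ P : (M.baseChange L).toAffine.Point, goodReductionHom M hv hΔu P = 0 →
        ((p ^ k : ℕ) : ℤ) • P = 0 → ∃ c : ℕ, P = c • P₀ := by
  haveI hM : M.IsElliptic := ⟨hΔu⟩
  set red := goodReductionHom M hv hΔu with hred
  have hcard := fun j ↦ (natCard_torsionBy_ker_goodReductionHom_eq O hv hΔu hord j).1
  have hfin : ∀ j : ℕ, Finite (torsionBy red.ker ((p : ℤ) ^ j)) := fun j ↦
    Nat.finite_of_card_ne_zero (by rw [hcard j]; exact pow_ne_zero j hp.out.ne_zero)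
  -- an element of `E₁ ∩ E[p^k]` of order exactly `p^k`
  obtain ⟨P₀, hP₀k, hord₀⟩ : ∃ P₀ : red.ker, (p : ℤ) ^ k • P₀ = 0 ∧ addOrderOf P₀ = p ^ k := by
    rcases Nat.eq_zero_or_pos k with rfl | hk
    · exact ⟨0, by rw [pow_zero, one_smul], by rw [pow_zero, addOrderOf_zero]⟩
    · -- `E₁ ∩ E[p^{k-1}] ⊊ E₁ ∩ E[p^k]` by cardinality
      haveI := hfin k
      haveI := hfin (k - 1)
      have hlt : Nat.card (torsionBy red.ker ((p : ℤ) ^ (k - 1))) <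
          Nat.card (torsionBy red.ker ((p : ℤ) ^ k)) := by
        rw [hcard, hcard]
        exact Nat.pow_lt_pow_right hp.out.one_lt (Nat.sub_lt hk one_pos)
      obtain ⟨x, hx⟩ : ∃ x : torsionBy red.ker ((p : ℤ) ^ k),
          (x : red.ker) ∉ torsionBy red.ker ((p : ℤ) ^ (k - 1)) := by
        by_contra hall
        push Not at hall
        have hinj : Function.Injective (fun x : torsionBy red.ker ((p : ℤ) ^ k) ↦
            (⟨(x : red.ker), hall x⟩ : torsionBy red.ker ((p : ℤ) ^ (k - 1)))) := fun x y h ↦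
          Subtype.ext (by
            have h' := congrArg (fun z : torsionBy red.ker ((p : ℤ) ^ (k - 1)) ↦ (z : red.ker)) h
            simpa using h')
        exact absurd (Nat.card_le_card_of_injective _ hinj) (not_le.mpr hlt)
      refine ⟨(x : red.ker), mem_torsionBy_iff.mp x.2, ?_⟩
      -- the order divides `p^k` and does not divide `p^{k-1}`
      have hdvd : addOrderOf (x : red.ker) ∣ p ^ k := by
        apply addOrderOf_dvd_of_nsmul_eq_zero
        have := mem_torsionBy_iff.mp x.2
        rwa [← natCast_zsmul, Nat.cast_pow]
      obtain ⟨i, hi, hci⟩ := (Nat.dvd_prime_pow hp.out).mp hdvd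
      rw [hci]
      rcases Nat.lt_or_ge i k with hik | hik
      · exfalso
        apply hx
        rw [mem_torsionBy_iff, ← Nat.cast_pow, natCast_zsmul]
        apply addOrderOf_dvd_iff_nsmul_eq_zero.mp
        rw [hci]
        exact pow_dvd_pow p (Nat.le_sub_one_of_lt hik)
      · rw [le_antisymm hi hik]
  -- `P₀` generates `E₁ ∩ E[p^k]`
  haveI := hfin k
  refine ⟨(P₀ : (M.baseChange L).toAffine.Point), P₀.2, ?_, fun P hP hPk ↦ ?_⟩
  · rw [← hord₀]
    exact addOrderOf_injective red.ker.subtype red.ker.subtype_injective P₀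
  · -- compare `zmultiples P₀` with `E₁ ∩ E[p^k]` inside `red.ker`
    have hle : AddSubgroup.zmultiples P₀ ≤ torsionBy red.ker ((p : ℤ) ^ k) := by
      rw [AddSubgroup.zmultiples_le]
      exact mem_torsionBy_iff.mpr hP₀k
    have hcardz : Nat.card (AddSubgroup.zmultiples P₀) = p ^ k := by
      rw [Nat.card_zmultiples, hord₀]
    have heq : AddSubgroup.zmultiples P₀ = torsionBy red.ker ((p : ℤ) ^ k) :=
      AddSubgroup.eq_of_le_of_card_ge hle (by rw [hcardz, hcard k])
    have hPmem : (⟨P, hP⟩ : red.ker) ∈ torsionBy red.ker ((p : ℤ) ^ k) := by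
      rw [mem_torsionBy_iff]
      apply red.ker.subtype_injective
      rw [map_zsmul, map_zero, ← Nat.cast_pow]
      exact hPk
    rw [← heq, AddSubgroup.mem_zmultiples_iff] at hPmem
    obtain ⟨m, hm⟩ := hPmem
    -- reduce the integer `m` modulo `p^k` to a natural number
    have hpk0 : ((p ^ k : ℕ) : ℤ) ≠ 0 := by exact_mod_cast pow_ne_zero k hp.out.ne_zero
    refine ⟨(m % ((p ^ k : ℕ) : ℤ)).toNat, ?_⟩
    have hm' : m • (P₀ : (M.baseChange L).toAffine.Point) = P := by
      have := congrArg red.ker.subtype hm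
      rwa [map_zsmul] at this
    have hP₀k' : ((p ^ k : ℕ) : ℤ) • (P₀ : (M.baseChange L).toAffine.Point) = 0 := by
      have := congrArg red.ker.subtype hP₀k
      rwa [map_zsmul, map_zero, ← Nat.cast_pow] at this
    rw [← natCast_zsmul, Int.toNat_of_nonneg (Int.emod_nonneg _ hpk0), Int.emod_def, sub_smul,
      mul_comm, mul_smul, hP₀k', smul_zero, sub_zero, hm']

end OrdinaryFiltration

end Literature.NumberTheory.EllipticCurves
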